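import Summits.Ventures.YMGap.Thresholds.OneLinkLevelTwoBootTildeEnvelope
import HarnessLib

/-!
# Venture YMGap — the one-link modulus beyond first order, part 54: ROWS of the `ω̃` bootstrap modulus `K₂BT` through the star
# door — `MassGapAt 4 N x` / `ImprovedThreshold 4 N x` for every `N ≥ 4 / 5 / 6 / 8 / 10 / 12 / 20 / 50`

HONEST FRAMING: venture file of the cell `pub-ymgap` (QuantumFields programme), strong-coupling LATTICE statements for `SU(N)`
lattice Yang–Mills on `ℤ⁴` (Wilson action, tree coupling `N·x`, 't Hooft `x`); nothing about the continuum; no decay rate beyond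
`∃ c > 0`.  OUTPUT (hypothesis-free, kernel-checked): `oneLinkKRModulus_levelTwoBT_of_le` at radius `R₀ = 6x₀` fed with the RATIONAL
majorants `casimirFactor_le`, `levelTwoE_le`, `sqrt_omegaPlus_le` (`p`), `omegaTilde_le` (`q,t,u`), `tau_le` (`q,t`), `levelTwoQTK_le`,
then ds-1's star door `StarSUNLimit.star_massGapAt_of_oneLinkKRModulus` (`4·K̄·|x| ≤ 9/25`, closed by `norm_num` on rationals — no
multi-kB real-arithmetic statement is elaborated anywhere in this file):
* `improvedThreshold_SU_levelTwoBT_four (4 ≤ N) : ImprovedThreshold 4 N (19 / 500)` (`0.0380`; `K₂B` column `3/80`);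
* `improvedThreshold_SU_levelTwoBT_five (5 ≤ N) : ImprovedThreshold 4 N (1 / 25)` (`0.0400`; `K₂B` column `79/2000`);
* `improvedThreshold_SU_levelTwoBT_six (6 ≤ N) : ImprovedThreshold 4 N (1 / 24)` (`0.0417`; `K₂B` column `41/1000`);
* `improvedThreshold_SU_levelTwoBT_eight (8 ≤ N) : ImprovedThreshold 4 N (13 / 300)` (`0.0433`; `K₂B` column `17/400`);
* `improvedThreshold_SU_levelTwoBT_ten (10 ≤ N) : ImprovedThreshold 4 N (11 / 250)` (`0.0440`; `K₂B` column `43/1000`);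
* `improvedThreshold_SU_levelTwoBT_twelve (12 ≤ N) : ImprovedThreshold 4 N (89 / 2000)` (`0.0445`; `K₂B` column `87/2000`);
* `improvedThreshold_SU_levelTwoBT_twenty (20 ≤ N) : ImprovedThreshold 4 N (91 / 2000)` (`0.0455`; `K₂B` column `11/250`);
* `improvedThreshold_SU_levelTwoBT_fifty (50 ≤ N) : ImprovedThreshold 4 N (11 / 240)` (`0.0458`; `K₂B` column `11/250 (N ≥ 20 row)`);
Against the sharp Bakry–Émery window `1/32`: `+22 %` (`N ≥ 4`) … `+47 %` (`N ≥ 50`); against SZZ's printed `1/48`: `×1.82 … ×2.2`;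
float supremum of this column as `N → ∞`: `0.0460`.  Sentence-grade all-`N` rows (cell ruling R140(b): not a headline); exact
rationals and margins: cell folder `work/hier/rows_pick_bt.py` / `rows_check_bt.py`.
-/

noncomputable section

open scoped Matrix ComplexConjugate BigOperators ContDiff Matrix.Norms.Frobenius
open Matrix Complex Finset MeasureTheory ProbabilityTheory
open Literature.MathematicalPhysics.QuantumFieldTheory
open Literature.MathematicalPhysics.QuantumFieldTheory.SUNBakryEmery
open Literature.MathematicalPhysics.QuantumFieldTheory.Balaban1983to89.StrongCouplingDobrushinWindow
open Literature.MathematicalPhysics.QuantumFieldTheory.Balaban1983to89.StrongCouplingKernelWindow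

namespace Summit.Ventures.YMGap.OneLinkEigen

variable {N : ℕ}

section LevelTwoBTRows

open Summit.Ventures.YMGap.StarSUNLimit (star_massGapAt_of_oneLinkKRModulus)
open Summit.Ventures.YMGap.OneLinkEigenRows (casimirFactor_le)

/-- **The `ω̃`-bootstrap modulus at a rational bracket**: for `N ≥ N₀ ≥ 3`, `R₀ < 1/2` and rationals `q, p, t, u ≥ 0` with
`q² ≥ R₀²/4 + 1/N₀²`, `p² ≥ (1 + ω̄⁺)/2`, `t² ≥ b̄²/4 + c̄`, `u² ≥ (τ̄ + R₀²)²/16 + R₀²/N₀²`: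
`OneLinkKRModulus N R₀ (K̄₂BT(N₀,R₀; q,p,t,u))`, `K̄₂BT = C(N₀)(p + E(N₀)R₀ + 2(E(N₀)+¼)ω̃̄ + ((3/2)E(N₀)R₀² + (2E(N₀)+¼)τ̄ + (10E(N₀)+½)R₀ω̃̄)/(½−R₀)
+ (3/2)E(N₀)R₀²·K̄₂QT)` — the row socket (the constant is produced by unification, never written). [folklore] -/
theorem oneLinkKRModulus_levelTwoBT_bracket {N₀ : ℕ} (hN₀ : 3 ≤ N₀) (hN : N₀ ≤ N) {R₀ q p t u : ℝ} (hR0 : 0 ≤ R₀) (hR₀ : R₀ < 1 / 2)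
    (hq : 0 ≤ q) (hq2 : R₀ ^ 2 / 4 + 1 / (N₀ : ℝ) ^ 2 ≤ q ^ 2) (hp : 0 ≤ p)
    (hp2 : (1 + ((2 * ((2 * (N₀ : ℝ) ^ 2 - 4) / (4 * (N₀ : ℝ) ^ 2 - 20)) * ((R₀) + ((R₀) ^ 2 / 2 + (R₀) * (q))) + 2 * (2 * (N₀ : ℝ) ^ 2 / (4 * (N₀ : ℝ) ^ 2 - 20)) * (((R₀) ^ 2 / 2 + (R₀) * (q)) + (R₀) * ((R₀) / 2 + (q)) ^ 2)))) / 2 ≤ p ^ 2) (ht : 0 ≤ t)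
    (ht2 : ((R₀) ^ 2 * (1 + (R₀) / 2 + (q)) / (2 - 4 / (N₀ : ℝ) ^ 2)) ^ 2 / 4 + ((R₀) ^ 2 * (4 / (N₀ : ℝ) ^ 2 + 2 * ((R₀) / 2 + (q)) ^ 2) / (2 - 4 / (N₀ : ℝ) ^ 2)) ≤ t ^ 2) (hu : 0 ≤ u)
    (hu2 : (((R₀) * (((R₀) ^ 2 * (1 + (R₀) / 2 + (q)) / (2 - 4 / (N₀ : ℝ) ^ 2)) / 2 + (t))) + R₀ ^ 2) ^ 2 / 16 + R₀ ^ 2 / (N₀ : ℝ) ^ 2 ≤ u ^ 2) :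
    OneLinkKRModulus N R₀
      (((N₀ : ℝ) ^ 2 / ((N₀ : ℝ) ^ 2 - 1)) *
        ((p) + ((N₀ : ℝ) ^ 2 / (2 * ((N₀ : ℝ) ^ 2 - 4))) * (R₀) + 2 * (((N₀ : ℝ) ^ 2 / (2 * ((N₀ : ℝ) ^ 2 - 4))) + 1 / 4) * ((((R₀) * (((R₀) ^ 2 * (1 + (R₀) / 2 + (q)) / (2 - 4 / (N₀ : ℝ) ^ 2)) / 2 + (t))) + (R₀) ^ 2) / 4 + (u))
          + (3 / 2 * ((N₀ : ℝ) ^ 2 / (2 * ((N₀ : ℝ) ^ 2 - 4))) * (R₀) ^ 2 + (2 * ((N₀ : ℝ) ^ 2 / (2 * ((N₀ : ℝ) ^ 2 - 4))) + 1 / 4) * ((R₀) * (((R₀) ^ 2 * (1 + (R₀) / 2 + (q)) / (2 - 4 / (N₀ : ℝ) ^ 2)) / 2 + (t)))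
              + (10 * ((N₀ : ℝ) ^ 2 / (2 * ((N₀ : ℝ) ^ 2 - 4))) + 1 / 2) * (R₀) * ((((R₀) * (((R₀) ^ 2 * (1 + (R₀) / 2 + (q)) / (2 - 4 / (N₀ : ℝ) ^ 2)) / 2 + (t))) + (R₀) ^ 2) / 4 + (u))) / (1 / 2 - (R₀))
          + 3 / 2 * ((N₀ : ℝ) ^ 2 / (2 * ((N₀ : ℝ) ^ 2 - 4))) * (R₀) ^ 2 * (((N₀ : ℝ) ^ 2 / ((N₀ : ℝ) ^ 2 - 1)) *
        ((p) + ((N₀ : ℝ) ^ 2 / (2 * ((N₀ : ℝ) ^ 2 - 4))) * (R₀) + 2 * (((N₀ : ℝ) ^ 2 / (2 * ((N₀ : ℝ) ^ 2 - 4))) + 1 / 4) * ((((R₀) * (((R₀) ^ 2 * (1 + (R₀) / 2 + (q)) / (2 - 4 / (N₀ : ℝ) ^ 2)) / 2 + (t))) + (R₀) ^ 2) / 4 + (u))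
          + (3 * ((N₀ : ℝ) ^ 2 / (2 * ((N₀ : ℝ) ^ 2 - 4))) * (R₀) ^ 2 + (2 * ((N₀ : ℝ) ^ 2 / (2 * ((N₀ : ℝ) ^ 2 - 4))) + 1 / 4) * ((R₀) * (((R₀) ^ 2 * (1 + (R₀) / 2 + (q)) / (2 - 4 / (N₀ : ℝ) ^ 2)) / 2 + (t)))
              + (10 * ((N₀ : ℝ) ^ 2 / (2 * ((N₀ : ℝ) ^ 2 - 4))) + 1 / 2) * (R₀) * ((((R₀) * (((R₀) ^ 2 * (1 + (R₀) / 2 + (q)) / (2 - 4 / (N₀ : ℝ) ^ 2)) / 2 + (t))) + (R₀) ^ 2) / 4 + (u))) / (1 / 2 - (R₀)))))) :=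
  oneLinkKRModulus_levelTwoBT_of_le (le_trans hN₀ hN) le_rfl hR₀ (casimirFactor_le (by omega) hN) (levelTwoE_le hN₀ hN)
    (sqrt_omegaPlus_le hN₀ hN hR0 le_rfl hq hq2 hp hp2) (omegaTilde_le hN₀ hN hR0 le_rfl hq hq2 ht ht2 hu hu2)
    (tau_le hN₀ hN hR0 le_rfl hq hq2 ht ht2) (levelTwoQTK_le hN₀ hN hR0 le_rfl hR₀ hq hq2 hp hp2 ht ht2 hu hu2)

/-- **`MassGapAt 4 N x` for every `N ≥ 4` at every 't Hooft `|x| ≤ 19 / 500`** (`0.0380`; `K₂B` column of record `3/80`), hypothesis-free,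
by the DS route (star door) with the `ω̃`-bootstrap modulus at the bracket `R₀ = 57 / 250`, `q = 687 / 2500`, `p = 1779 / 2000`, `t = 519 / 4000`, `u = 1219 / 20000`
(`K̄₂BT·x₀ = 0.08938 ≤ 9/100`). [folklore] -/
theorem massGapAt_SU_levelTwoBT_four (hN : 4 ≤ N) {x : ℝ} (h : |x| ≤ 19 / 500) : MassGapAt 4 N x := by
  have hR : |x| * 6 ≤ 57 / 250 := by linarith only [h]
  have hmod := oneLinkKRModulus_levelTwoBT_bracket (N₀ := 4) (N := N) (by norm_num) hN (R₀ := 57 / 250) (q := 687 / 2500) (p := 1779 / 2000)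
    (t := 519 / 4000) (u := 1219 / 20000) (by norm_num) (by norm_num) (by norm_num) (by norm_num) (by norm_num) (by norm_num) (by norm_num)
    (by norm_num) (by norm_num) (by norm_num)
  refine star_massGapAt_of_oneLinkKRModulus (by omega) ?_ hR hmod (star_door_of_envelope le_rfl h (abs_nonneg x) ?_ ?_) <;>
    norm_num

/-- **`ImprovedThreshold 4 N (19 / 500)` for every `N ≥ 4`, hypothesis-free** (`0.0380`). [folklore] -/
theorem improvedThreshold_SU_levelTwoBT_four (hN : 4 ≤ N) : ImprovedThreshold 4 N (19 / 500) :=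
  ⟨by norm_num, fun _ hx => massGapAt_SU_levelTwoBT_four hN hx.le⟩

/-- **`MassGapAt 4 N x` for every `N ≥ 5` at every 't Hooft `|x| ≤ 1 / 25`** (`0.0400`; `K₂B` column of record `79/2000`), hypothesis-free,
by the DS route (star door) with the `ω̃`-bootstrap modulus at the bracket `R₀ = 6 / 25`, `q = 2333 / 10000`, `p = 871 / 1000`, `t = 11521 / 100000`, `u = 1061 / 20000`
(`K̄₂BT·x₀ = 0.08698 ≤ 9/100`). [folklore] -/
theorem massGapAt_SU_levelTwoBT_five (hN : 5 ≤ N) {x : ℝ} (h : |x| ≤ 1 / 25) : MassGapAt 4 N x := by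
  have hR : |x| * 6 ≤ 6 / 25 := by linarith only [h]
  have hmod := oneLinkKRModulus_levelTwoBT_bracket (N₀ := 5) (N := N) (by norm_num) hN (R₀ := 6 / 25) (q := 2333 / 10000) (p := 871 / 1000)
    (t := 11521 / 100000) (u := 1061 / 20000) (by norm_num) (by norm_num) (by norm_num) (by norm_num) (by norm_num) (by norm_num) (by norm_num)
    (by norm_num) (by norm_num) (by norm_num)
  refine star_massGapAt_of_oneLinkKRModulus (by omega) ?_ hR hmod (star_door_of_envelope le_rfl h (abs_nonneg x) ?_ ?_) <;>
    norm_num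

/-- **`ImprovedThreshold 4 N (1 / 25)` for every `N ≥ 5`, hypothesis-free** (`0.0400`). [folklore] -/
theorem improvedThreshold_SU_levelTwoBT_five (hN : 5 ≤ N) : ImprovedThreshold 4 N (1 / 25) :=
  ⟨by norm_num, fun _ hx => massGapAt_SU_levelTwoBT_five hN hx.le⟩

/-- **`MassGapAt 4 N x` for every `N ≥ 6` at every 't Hooft `|x| ≤ 1 / 24`** (`0.0417`; `K₂B` column of record `41/1000`), hypothesis-free,
by the DS route (star door) with the `ω̃`-bootstrap modulus at the bracket `R₀ = 1 / 4`, `q = 521 / 2500`, `p = 1729 / 2000`, `t = 10733 / 100000`, `u = 959 / 20000`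
(`K̄₂BT·x₀ = 0.08857 ≤ 9/100`). [folklore] -/
theorem massGapAt_SU_levelTwoBT_six (hN : 6 ≤ N) {x : ℝ} (h : |x| ≤ 1 / 24) : MassGapAt 4 N x := by
  have hR : |x| * 6 ≤ 1 / 4 := by linarith only [h]
  have hmod := oneLinkKRModulus_levelTwoBT_bracket (N₀ := 6) (N := N) (by norm_num) hN (R₀ := 1 / 4) (q := 521 / 2500) (p := 1729 / 2000)
    (t := 10733 / 100000) (u := 959 / 20000) (by norm_num) (by norm_num) (by norm_num) (by norm_num) (by norm_num) (by norm_num) (by norm_num)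
    (by norm_num) (by norm_num) (by norm_num)
  refine star_massGapAt_of_oneLinkKRModulus (by omega) ?_ hR hmod (star_door_of_envelope le_rfl h (abs_nonneg x) ?_ ?_) <;>
    norm_num

/-- **`ImprovedThreshold 4 N (1 / 24)` for every `N ≥ 6`, hypothesis-free** (`0.0417`). [folklore] -/
theorem improvedThreshold_SU_levelTwoBT_six (hN : 6 ≤ N) : ImprovedThreshold 4 N (1 / 24) :=
  ⟨by norm_num, fun _ hx => massGapAt_SU_levelTwoBT_six hN hx.le⟩

/-- **`MassGapAt 4 N x` for every `N ≥ 8` at every 't Hooft `|x| ≤ 13 / 300`** (`0.0433`; `K₂B` column of record `17/400`), hypothesis-free,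
by the DS route (star door) with the `ω̃`-bootstrap modulus at the bracket `R₀ = 13 / 50`, `q = 451 / 2500`, `p = 4291 / 5000`, `t = 9709 / 100000`, `u = 2041 / 50000`
(`K̄₂BT·x₀ = 0.08924 ≤ 9/100`). [folklore] -/
theorem massGapAt_SU_levelTwoBT_eight (hN : 8 ≤ N) {x : ℝ} (h : |x| ≤ 13 / 300) : MassGapAt 4 N x := by
  have hR : |x| * 6 ≤ 13 / 50 := by linarith only [h]
  have hmod := oneLinkKRModulus_levelTwoBT_bracket (N₀ := 8) (N := N) (by norm_num) hN (R₀ := 13 / 50) (q := 451 / 2500) (p := 4291 / 5000)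
    (t := 9709 / 100000) (u := 2041 / 50000) (by norm_num) (by norm_num) (by norm_num) (by norm_num) (by norm_num) (by norm_num) (by norm_num)
    (by norm_num) (by norm_num) (by norm_num)
  refine star_massGapAt_of_oneLinkKRModulus (by omega) ?_ hR hmod (star_door_of_envelope le_rfl h (abs_nonneg x) ?_ ?_) <;>
    norm_num

/-- **`ImprovedThreshold 4 N (13 / 300)` for every `N ≥ 8`, hypothesis-free** (`0.0433`). [folklore] -/
theorem improvedThreshold_SU_levelTwoBT_eight (hN : 8 ≤ N) : ImprovedThreshold 4 N (13 / 300) :=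
  ⟨by norm_num, fun _ hx => massGapAt_SU_levelTwoBT_eight hN hx.le⟩

/-- **`MassGapAt 4 N x` for every `N ≥ 10` at every 't Hooft `|x| ≤ 11 / 250`** (`0.0440`; `K₂B` column of record `43/1000`), hypothesis-free,
by the DS route (star door) with the `ω̃`-bootstrap modulus at the bracket `R₀ = 33 / 125`, `q = 1657 / 10000`, `p = 8547 / 10000`, `t = 284 / 3125`, `u = 3633 / 100000`
(`K̄₂BT·x₀ = 0.08840 ≤ 9/100`). [folklore] -/
theorem massGapAt_SU_levelTwoBT_ten (hN : 10 ≤ N) {x : ℝ} (h : |x| ≤ 11 / 250) : MassGapAt 4 N x := by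
  have hR : |x| * 6 ≤ 33 / 125 := by linarith only [h]
  have hmod := oneLinkKRModulus_levelTwoBT_bracket (N₀ := 10) (N := N) (by norm_num) hN (R₀ := 33 / 125) (q := 1657 / 10000) (p := 8547 / 10000)
    (t := 284 / 3125) (u := 3633 / 100000) (by norm_num) (by norm_num) (by norm_num) (by norm_num) (by norm_num) (by norm_num) (by norm_num)
    (by norm_num) (by norm_num) (by norm_num)
  refine star_massGapAt_of_oneLinkKRModulus (by omega) ?_ hR hmod (star_door_of_envelope le_rfl h (abs_nonneg x) ?_ ?_) <;>
    norm_num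

/-- **`ImprovedThreshold 4 N (11 / 250)` for every `N ≥ 10`, hypothesis-free** (`0.0440`). [folklore] -/
theorem improvedThreshold_SU_levelTwoBT_ten (hN : 10 ≤ N) : ImprovedThreshold 4 N (11 / 250) :=
  ⟨by norm_num, fun _ hx => massGapAt_SU_levelTwoBT_ten hN hx.le⟩

/-- **`MassGapAt 4 N x` for every `N ≥ 12` at every 't Hooft `|x| ≤ 89 / 2000`** (`0.0445`; `K₂B` column of record `87/2000`), hypothesis-free,
by the DS route (star door) with the `ω̃`-bootstrap modulus at the bracket `R₀ = 267 / 1000`, `q = 787 / 5000`, `p = 8533 / 10000`, `t = 2189 / 25000`, `u = 841 / 25000`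
(`K̄₂BT·x₀ = 0.08854 ≤ 9/100`). [folklore] -/
theorem massGapAt_SU_levelTwoBT_twelve (hN : 12 ≤ N) {x : ℝ} (h : |x| ≤ 89 / 2000) : MassGapAt 4 N x := by
  have hR : |x| * 6 ≤ 267 / 1000 := by linarith only [h]
  have hmod := oneLinkKRModulus_levelTwoBT_bracket (N₀ := 12) (N := N) (by norm_num) hN (R₀ := 267 / 1000) (q := 787 / 5000) (p := 8533 / 10000)
    (t := 2189 / 25000) (u := 841 / 25000) (by norm_num) (by norm_num) (by norm_num) (by norm_num) (by norm_num) (by norm_num) (by norm_num)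
    (by norm_num) (by norm_num) (by norm_num)
  refine star_massGapAt_of_oneLinkKRModulus (by omega) ?_ hR hmod (star_door_of_envelope le_rfl h (abs_nonneg x) ?_ ?_) <;>
    norm_num

/-- **`ImprovedThreshold 4 N (89 / 2000)` for every `N ≥ 12`, hypothesis-free** (`0.0445`). [folklore] -/
theorem improvedThreshold_SU_levelTwoBT_twelve (hN : 12 ≤ N) : ImprovedThreshold 4 N (89 / 2000) :=
  ⟨by norm_num, fun _ hx => massGapAt_SU_levelTwoBT_twelve hN hx.le⟩

/-- **`MassGapAt 4 N x` for every `N ≥ 20` at every 't Hooft `|x| ≤ 91 / 2000`** (`0.0455`; `K₂B` column of record `11/250`), hypothesis-free,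
by the DS route (star door) with the `ω̃`-bootstrap modulus at the bracket `R₀ = 273 / 1000`, `q = 727 / 5000`, `p = 8523 / 10000`, `t = 8309 / 100000`, `u = 733 / 25000`
(`K̄₂BT·x₀ = 0.08998 ≤ 9/100`). [folklore] -/
theorem massGapAt_SU_levelTwoBT_twenty (hN : 20 ≤ N) {x : ℝ} (h : |x| ≤ 91 / 2000) : MassGapAt 4 N x := by
  have hR : |x| * 6 ≤ 273 / 1000 := by linarith only [h]
  have hmod := oneLinkKRModulus_levelTwoBT_bracket (N₀ := 20) (N := N) (by norm_num) hN (R₀ := 273 / 1000) (q := 727 / 5000) (p := 8523 / 10000)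
    (t := 8309 / 100000) (u := 733 / 25000) (by norm_num) (by norm_num) (by norm_num) (by norm_num) (by norm_num) (by norm_num) (by norm_num)
    (by norm_num) (by norm_num) (by norm_num)
  refine star_massGapAt_of_oneLinkKRModulus (by omega) ?_ hR hmod (star_door_of_envelope le_rfl h (abs_nonneg x) ?_ ?_) <;>
    norm_num

/-- **`ImprovedThreshold 4 N (91 / 2000)` for every `N ≥ 20`, hypothesis-free** (`0.0455`). [folklore] -/
theorem improvedThreshold_SU_levelTwoBT_twenty (hN : 20 ≤ N) : ImprovedThreshold 4 N (91 / 2000) :=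
  ⟨by norm_num, fun _ hx => massGapAt_SU_levelTwoBT_twenty hN hx.le⟩

/-- **`MassGapAt 4 N x` for every `N ≥ 50` at every 't Hooft `|x| ≤ 11 / 240`** (`0.0458`; `K₂B` column of record `11/250 (N ≥ 20 row)`), hypothesis-free,
by the DS route (star door) with the `ω̃`-bootstrap modulus at the bracket `R₀ = 11 / 40`, `q = 139 / 1000`, `p = 8511 / 10000`, `t = 8019 / 100000`, `u = 1333 / 50000`
(`K̄₂BT·x₀ = 0.08959 ≤ 9/100`). [folklore] -/
theorem massGapAt_SU_levelTwoBT_fifty (hN : 50 ≤ N) {x : ℝ} (h : |x| ≤ 11 / 240) : MassGapAt 4 N x := by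
  have hR : |x| * 6 ≤ 11 / 40 := by linarith only [h]
  have hmod := oneLinkKRModulus_levelTwoBT_bracket (N₀ := 50) (N := N) (by norm_num) hN (R₀ := 11 / 40) (q := 139 / 1000) (p := 8511 / 10000)
    (t := 8019 / 100000) (u := 1333 / 50000) (by norm_num) (by norm_num) (by norm_num) (by norm_num) (by norm_num) (by norm_num) (by norm_num)
    (by norm_num) (by norm_num) (by norm_num)
  refine star_massGapAt_of_oneLinkKRModulus (by omega) ?_ hR hmod (star_door_of_envelope le_rfl h (abs_nonneg x) ?_ ?_) <;>
    norm_num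

/-- **`ImprovedThreshold 4 N (11 / 240)` for every `N ≥ 50`, hypothesis-free** (`0.0458`). [folklore] -/
theorem improvedThreshold_SU_levelTwoBT_fifty (hN : 50 ≤ N) : ImprovedThreshold 4 N (11 / 240) :=
  ⟨by norm_num, fun _ hx => massGapAt_SU_levelTwoBT_fifty hN hx.le⟩

/-- The threshold arithmetic of this column (`d = 4`, 't Hooft `x`): the rows against SZZ's `1/48`, the sharp Bakry–Émery `1/32`
and the `K₂B` column of record. [folklore] -/
theorem threshold_numbers_levelTwoBT :
    (1 : ℝ) / 48 < 1 / 32 ∧ (3 : ℝ) / 80 < 19 / 500 ∧ (79 : ℝ) / 2000 < 1 / 25 ∧ (41 : ℝ) / 1000 < 1 / 24 ∧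
      (17 : ℝ) / 400 < 13 / 300 ∧ (43 : ℝ) / 1000 < 11 / 250 ∧ (87 : ℝ) / 2000 < 89 / 2000 ∧ (11 : ℝ) / 250 < 91 / 2000 ∧
      (91 : ℝ) / 2000 < 11 / 240 ∧ (11 : ℝ) / 240 < 1 / 12 := by
  norm_num

end LevelTwoBTRows

end Summit.Ventures.YMGap.OneLinkEigen
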